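import Summits.MatrixMultiplication.OmegaCensus.ThreeSetLineUnitObstruction
import Mathlib.RingTheory.AdjoinRoot
import Mathlib.RingTheory.Polynomial.Cyclotomic.Basic
import HarnessLib

/-!
# The norm divisibility `N(D_X) ∣ N(Γ_s)` forced by the three-set line identity (the "norm filter"; abstract half)

ω-census `pub-omega`, family (b3), seat pub-omega-group gen 41.  Framing: lottery ticket; floor = certified bounds/negative
ranges.  VALUE: a kernel TOOL for the three-set cube cells `(4, d, e)@p²` of the Dih-side law census; NOT progress on ω and not a
proof of LINE LEMMA (β).  It is the theorem behind a certificate-FREE computation: an `X`-datum `F` is dead for the killer `W`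
unless the integer `N(D_X)` divides one of the `p` integers `N(Γ_s)` — at `p = 29` only ≈ 0.1 % of the data survive this test
(seat notes `RESULTS-g41.md`, HOME/pub-omega-group-g41/), and only those need the local certificates of
`ThreeSetLineUnitCertificate`.

Setting: the three-set line identity `Σ_u (Σ_v W(v)(F(τ−u+v) + F(v+u−τ) + F(τ+u−v)))·G(u) + [s = τ] = K` on `ZMod p`
(`lineMat3`), `p` prime.  Let `S = ℤ[X]/(Φ_p)` (`AdjoinRoot (cyclotomic p ℤ)`, `Φ_p = Σ_{i<p} X^i`, `ring`), `ρ` the class of `X`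
(`Σ_{i<p} ρ^i = 0`, `geom_sum_root`), and for `1 ≤ j ≤ p − 1` let `σ_j : S →+* S` be the endomorphism `ρ ↦ ρ^j` (`sig`, built with
`AdjoinRoot.lift`; `Σ_i (ρ^j)^i = 0` is `geom_sum_zch_eq_zero`).  Put `Nm z := ∏_{j=1}^{p−1} σ_j z` (`normS`; multiplicative,
`normS_mul`) and let `λ : S → ℤ` be "coefficient of `X⁰` of the reduced representative" (`coeff0`, from
`AdjoinRoot.modByMonicHom`; `ℤ`-linear with `λ(n) = n`).
* `dvd_of_natCast_mul_eq` — if `(n : S) · Z = (g : S)` then `n ∣ g` in `ℤ` (apply `λ`): no Galois theory is needed to read off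
  an integer, and none is claimed (`Nm z ∈ ℤ` is true but not proved here — the kernel checker VERIFIES it numerically for the
  one element it needs).
* **`norm_dvd_of_line_identity3`** — with `x = Σ F(v)ρ^v`, `x̄, w, w̄` likewise (`lev`, `levc`), `D_X = (xw̄)² + (xw̄)(x̄w) + (x̄w)²`
  and `Γ_s = w̄²ρ^{2s} − ww̄ + w²ρ^{−2s}`: a solution `G, K` of the identity with hole `s` gives `D_X · D_Y = Γ_s` in `S`
  (`LineUnit.threeD_mul_threeD_eq` at `r = ρ`), hence `Nm D_X · Nm D_Y = Nm Γ_s`; so whenever `Nm D_X = n` and `Nm Γ_s = g` for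
  integers `n, g` (the checker's two computations), **`n ∣ g`**.  Contrapositive (`no_line_identity3_of_norm`): `¬ n ∣ g` for
  this `s` ⇒ no solution with hole `s`.
The concrete half (packed group-ring arithmetic computing `n` per datum and `g` per hole, ≈ 15–20 ms per datum, no certificate
bytes) is the successor's `ThreeSetLineNormFilter`.
-/

namespace Summit.MatrixMultiplication.OmegaCensus

open Finset Polynomial

namespace LineNorm

variable (p : ℕ) [hp : Fact p.Prime]

/-- `S = ℤ[X]/(Φ_p)`. [folklore] -/
abbrev S : Type := AdjoinRoot (cyclotomic p ℤ)

/-- `ρ` = the class of `X` in `S`. [folklore] -/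
noncomputable def rho : S p := AdjoinRoot.root (cyclotomic p ℤ)

/-- `Φ_p(x) = Σ_{k<p} x^k` under any evaluation. [folklore] -/
theorem eval₂_cyclotomic_prime {T : Type*} [CommRing T] (i : ℤ →+* T) (x : T) :
    (cyclotomic p ℤ).eval₂ i x = ∑ k ∈ range p, x ^ k := by
  rw [cyclotomic_prime, eval₂_finsetSum]
  exact sum_congr rfl fun k _ => eval₂_X_pow _ _

/-- `Σ_{i<p} ρ^i = 0`. [folklore] -/
theorem geom_sum_root : ∑ i ∈ range p, rho p ^ i = 0 := by
  have h := AdjoinRoot.eval₂_root (cyclotomic p ℤ)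
  rwa [eval₂_cyclotomic_prime] at h

/-- `ρ^p = 1`. [folklore] -/
theorem root_pow_p : rho p ^ p = 1 := pow_eq_one_of_geom_sum_eq_zero (geom_sum_root p)

/-- `Σ_{i<p} (ρ^j)^i = 0` for `p ∤ j`. [folklore] -/
theorem geom_sum_root_pow {j : ℕ} (hj : ¬ p ∣ j) : ∑ i ∈ range p, (rho p ^ j) ^ i = 0 := by
  have hne : ((j : ℕ) : ZMod p) ≠ 0 := by rwa [Ne, ZMod.natCast_eq_zero_iff]
  have h := geom_sum_zch_eq_zero (geom_sum_root p) hne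
  have e : zch (rho p) ((j : ℕ) : ZMod p) = rho p ^ j := by
    rw [zch, ZMod.val_natCast, pow_mod_eq_pow (root_pow_p p)]
  rwa [e] at h

/-- The endomorphism `σ_j : ρ ↦ ρ^j` of `S` (`p ∤ j`). [folklore] -/
noncomputable def sig (j : ℕ) (hj : ¬ p ∣ j) : S p →+* S p :=
  AdjoinRoot.lift (AdjoinRoot.of (cyclotomic p ℤ)) (rho p ^ j) (by
    rw [eval₂_cyclotomic_prime]; exact geom_sum_root_pow p hj)

/-- `σ_j ρ = ρ^j`. [folklore] -/
theorem sig_rho (j : ℕ) (hj : ¬ p ∣ j) : sig p j hj (rho p) = rho p ^ j := by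
  unfold sig rho
  exact AdjoinRoot.lift_root _

/-- `σ_j` fixes the integers. [folklore] -/
theorem sig_intCast (j : ℕ) (hj : ¬ p ∣ j) (n : ℤ) : sig p j hj (n : S p) = n := map_intCast _ n

omit hp in
/-- `1 ≤ j + 1 ≤ p − 1` is not divisible by `p`. [folklore] -/
theorem not_dvd_succ_of_lt {j : ℕ} (hj : j < p - 1) : ¬ p ∣ j + 1 := fun h =>
  absurd (Nat.le_of_dvd (Nat.succ_pos j) h) (by omega)

/-- The norm-like product `Nm z = ∏_{j=1}^{p−1} σ_j z` (an element of `S`; it is in fact the integer `N_{ℚ(ζ_p)/ℚ}(z)`, which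
is not proved here). [folklore] -/
noncomputable def normS (z : S p) : S p :=
  ∏ j ∈ (range (p - 1)).attach, sig p (j.1 + 1) (not_dvd_succ_of_lt p (mem_range.1 j.2)) z

/-- `Nm` is multiplicative. [folklore] -/
theorem normS_mul (a b : S p) : normS p (a * b) = normS p a * normS p b := by
  unfold normS
  rw [← prod_mul_distrib]
  exact prod_congr rfl fun j _ => map_mul _ a b

/-- The `ℤ`-linear functional "coefficient of `X⁰` of the reduced representative". [folklore] -/
noncomputable def coeff0 (z : S p) : ℤ := (AdjoinRoot.modByMonicHom (cyclotomic.monic p ℤ) z).coeff 0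

/-- `coeff0` of an integer is the integer (`deg Φ_p = p − 1 ≥ 1`). [folklore] -/
theorem coeff0_intCast (n : ℤ) : coeff0 p (n : S p) = n := by
  unfold coeff0
  have e : (n : S p) = AdjoinRoot.mk (cyclotomic p ℤ) (C n) := by
    rw [AdjoinRoot.mk_C]; rfl
  rw [e, AdjoinRoot.modByMonicHom_mk, (modByMonic_eq_self_iff (cyclotomic.monic p ℤ)).2, coeff_C_zero]
  rw [degree_cyclotomic, Nat.totient_prime hp.out]
  refine lt_of_le_of_lt degree_C_le ?_
  have : 1 ≤ p - 1 := by have := hp.out.two_le; omega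
  exact_mod_cast this

omit hp in
/-- `coeff0 (n · z) = n · coeff0 z`. [folklore] -/
theorem coeff0_intCast_mul (n : ℤ) (z : S p) : coeff0 p ((n : S p) * z) = n * coeff0 p z := by
  unfold coeff0
  rw [← zsmul_eq_mul, LinearMap.map_smul, coeff_smul, smul_eq_mul]

/-- **Reading off an integer**: `(n : S)·Z = (g : S)` forces `n ∣ g`. [folklore] -/
theorem dvd_of_intCast_mul_eq {n g : ℤ} {Z : S p} (h : (n : S p) * Z = (g : S p)) : n ∣ g :=
  ⟨coeff0 p Z, by rw [← coeff0_intCast_mul, h, coeff0_intCast]⟩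

variable {p}

/-- **The norm divisibility.**  For a solution of the three-set line identity with hole `s`, and `ρ ∈ S = ℤ[X]/(Φ_p)`:
if `Nm D_X = n` and `Nm Γ_s = g` (`D_X = (xw̄)² + (xw̄)(x̄w) + (x̄w)²`, `Γ_s = w̄²ρ^{2s} − ww̄ + w²ρ^{−2s}`, character sums at `ρ`)
then `n ∣ g`. [folklore] -/
theorem norm_dvd_of_line_identity3 (W F G : ZMod p → ℕ) (s : ZMod p) (K : ℕ)
    (hid : ∀ τ : ZMod p, (∑ u : ZMod p, lineMat3 W F τ u * G u) + (if s = τ then 1 else 0) = K) {n g : ℤ}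
    (hn : normS p ((lev (rho p) F * levc (rho p) W) ^ 2 + (lev (rho p) F * levc (rho p) W) * (levc (rho p) F * lev (rho p) W)
      + (levc (rho p) F * lev (rho p) W) ^ 2) = (n : S p))
    (hg : normS p (levc (rho p) W ^ 2 * zch (rho p) s ^ 2 - lev (rho p) W * levc (rho p) W
      + lev (rho p) W ^ 2 * zch (rho p) (-s) ^ 2) = (g : S p)) : n ∣ g := by
  have hr := geom_sum_root p
  have h1 := root_pow_p p
  set ρ := rho p
  have hu : levc ρ W * lev ρ F * lev ρ G + lev ρ W * levc ρ F * lev ρ G + lev ρ W * lev ρ F * levc ρ G = -zch ρ s :=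
    eq_neg_of_add_eq_zero_left (LineUnit.line_char_identity3 hr W F G s K hid)
  have hu' : lev ρ W * levc ρ F * levc ρ G + levc ρ W * lev ρ F * levc ρ G + levc ρ W * levc ρ F * lev ρ G =
      -zch ρ (-s) := eq_neg_of_add_eq_zero_left (LineUnit.line_char_identity3_conj hr W F G s K hid)
  have hzz : zch ρ s * zch ρ (-s) = 1 := zch_mul_zch_neg h1 s
  have key := LineUnit.threeD_mul_threeD_eq (w := lev ρ W) (w' := levc ρ W) (x := lev ρ F) (x' := levc ρ F) (y := lev ρ G)
    (y' := levc ρ G) hu hu' hzz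
  -- take `Nm` of `D_X · D_Y = Γ_s`
  have hN := congrArg (normS p) key
  rw [normS_mul, hn, hg] at hN
  exact dvd_of_intCast_mul_eq p hN

/-- **The norm filter** (contrapositive): if `Nm D_X = n`, `Nm Γ_s = g` and `¬ n ∣ g`, the identity has no solution with hole
`s`. [folklore] -/
theorem no_line_identity3_of_norm (W F : ZMod p → ℕ) (s : ZMod p) {n g : ℤ}
    (hn : normS p ((lev (rho p) F * levc (rho p) W) ^ 2 + (lev (rho p) F * levc (rho p) W) * (levc (rho p) F * lev (rho p) W)
      + (levc (rho p) F * lev (rho p) W) ^ 2) = (n : S p))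
    (hg : normS p (levc (rho p) W ^ 2 * zch (rho p) s ^ 2 - lev (rho p) W * levc (rho p) W
      + lev (rho p) W ^ 2 * zch (rho p) (-s) ^ 2) = (g : S p)) (hng : ¬ n ∣ g) (G : ZMod p → ℕ) (K : ℕ)
    (hid : ∀ τ : ZMod p, (∑ u : ZMod p, lineMat3 W F τ u * G u) + (if s = τ then 1 else 0) = K) : False :=
  hng (norm_dvd_of_line_identity3 W F G s K hid hn hg)

end LineNorm

end Summit.MatrixMultiplication.OmegaCensus
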